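import Summits.QuantumAdvantage.QuantumAdvantage.Theorems.CubicForrelationNearExactIsExactTwelveLevelFiveConfigCFlat
import Summits.QuantumAdvantage.QuantumAdvantage.Theorems.CubicForrelationNearExactIsExactTwelveLevelFiveR1DeadAt2932

/-!
# Crux `CubicForrelation.NearExactIsExact` (stmt-QuantumAdvantage-14043) — n = 12 AT `Φ = 29/32`: the Walsh transform of the `±2`-part of a
  configuration-(c) residual is `{0, ±512}`-valued, and TWO LEVEL-5 SIDES CANNOT FACE EACH OTHER

Certificate seat `b2b-cforr-cert` (gen 23).  HONEST FRAMING: kernel-checked finite-slice lemmas (standard axioms, no `decide`) about cubic Boolean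
pairs on 12 bits.  Consequence for the boundary rung: in a cubic pair with `Φ(f,g) ≥ 29/32` and `W_g = 32u'` with some `u'` odd (a level-5
side, necessarily in configuration (c) by `tw23_levelFive_ge2932_shape`), the partner `f` has `W_f ∈ 64ℤ` (level `≥ 6`).  Whether `29/32`
is a value at `n = 12` is NOT decided (left: level-5(c) × level-6 and level-6 × level-6).  NO new value of `θ₁₂`; NOT summit progress.

THE ARGUMENT.  Let `e = u' − 2(−1)^f` (`±1` on the odd hyperplane `P`, `±2` on the 8-flat `A = p ⊕ U ⊂ P'`, `0` elsewhere;
`…ConfigCFlat`).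
1. (`bd_hom_sum`) A multiplicative `±1`-function on a finite `⊕`-closed set sums to `0` or to the cardinality.
2. (`bd_Ohat`) `Ô(y) = Σ_{x∈A} e(x)(−1)^{x·y} = e(p)(−1)^{p·y}·Σ_{u∈U} η(u)` with `η(u) = e(p)e(p⊕u)(−1)^{u·y}/4` multiplicative on `U`
   (`cc_signs`), so `Ô(y) ∈ {0, ±512}`.
3. (`tw23_levelFive_both_false`) Parseval for `ê = ŝ + Ô` (`ŝ` the transform of `e·1_P`): `Σ ê² = 4096·3072`, `Σ ŝ² = 4096·2048`,
   `Σ Ô² = 4096·1024`, hence `Σ_y ê(y)Ô(y) = 2²²`.  If the partner were also at level 5 it would be in configuration (c) too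
   (`tw23_levelFive_ge2932_shape` for `(g,f)`), so `|e_f| ≤ 2` and `|ê| = 64|e_f| ≤ 128` (duality `l5k_duality`); with `|Ô| ∈ {0, 512}`,
   `Σ |Ô| = Σ Ô²/512 = 8192` and `Σ êÔ ≤ 128·8192 = 2²⁰ < 2²²` — contradiction.

References: MacWilliams–Sloane (1977) Ch. 13–15; R. O'Donnell (2014) §1.4; C. Carlet (2020) §2.3.  Axioms: the standard three.
-/

set_option linter.dupNamespace false -- D-0017: single-problem summit ⇒ `QuantumAdvantage.QuantumAdvantage` by design

noncomputable section

namespace Summit.QuantumAdvantage.QuantumAdvantage.Theorems.CubicForrelation.NearExactIsExact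

open Finset
open Literature.Computability.QuantumComplexity
open Literature.Computability.QuantumComplexity.BuzetChailloux (bxor zeroVec bxor_bxor_cancel_left bxor_zeroVec zeroVec_bxor bxor_comm
  bxor_self)
open Literature.Computability.QuantumComplexity.DerivativeWalsh (W)
open Literature.Computability.QuantumComplexity.BuzetChailloux (twist_bxor_right)
open Literature.Computability.QuantumComplexity.DerivativeWalsh (twist_bxor_left sum_W_sq)
open Literature.Computability.QuantumComplexity.Simon (twist_eq_one_or)

/-! ### 1. Character sums of multiplicative sign functions -/

/-- **A multiplicative `±1`-function on a finite `⊕`-closed set sums to `0` or to the cardinality.** [folklore] -/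
theorem bd_hom_sum {n : ℕ} (U : Finset (Fin n → Bool)) (hUadd : ∀ a ∈ U, ∀ b ∈ U, bxor a b ∈ U) (η : (Fin n → Bool) → ℝ)
    (hη : ∀ u ∈ U, η u = 1 ∨ η u = -1) (hmul : ∀ u ∈ U, ∀ v ∈ U, η (bxor u v) = η u * η v) :
    ∑ u ∈ U, η u = 0 ∨ ∑ u ∈ U, η u = #U := by
  by_cases hall : ∀ u ∈ U, η u = 1
  · right; rw [sum_congr rfl hall, sum_const, nsmul_eq_mul, mul_one]
  · left
    push Not at hall
    obtain ⟨u₀, hu₀, hne⟩ := hall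
    have hm1 : η u₀ = -1 := (hη u₀ hu₀).resolve_left hne
    have hre : ∑ u ∈ U, η (bxor u u₀) = ∑ u ∈ U, η u := gr20_sum_translate (fun x hx => hUadd x hx u₀ hu₀) η
    have h2 : ∑ u ∈ U, η (bxor u u₀) = ∑ u ∈ U, η u * η u₀ := sum_congr rfl fun u hu => hmul u hu u₀ hu₀
    rw [h2, ← sum_mul, hm1] at hre
    linarith

/-! ### 2. `Ô ∈ {0, ±512}` -/

/-- **The transform of the `±2`-part is `{0, ±512}`-valued**: in configuration (c), for every `y`,
`Σ_{x∈A} e(x)(−1)^{x·y} ∈ {0, 512, −512}`. [this work] -/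
theorem bd_Ohat (f g : (Fin (6 + 6) → Bool) → Bool) (hf : IsDegLeFun 3 f) (hg : IsDegLeFun 3 g)
    (u' : (Fin (6 + 6) → Bool) → ℤ) (hu' : ∀ x, W (fun y => signOf (g y)) x = (2 : ℝ) ^ 5 * (u' x : ℝ))
    (hodd : ∃ x, Odd (u' x)) (hΦ : (29 / 32 : ℝ) ≤ forrelation f g)
    (h2 : ∃ x, ¬ Odd (u' x) ∧ Odd ((u' x - 2 * sZ (f x)) / 2))
    (V : Finset (Fin (6 + 6) → Bool)) (xP x' : Fin (6 + 6) → Bool) (h0 : zeroVec ∈ V) (hadd : ∀ a ∈ V, ∀ b ∈ V, bxor a b ∈ V)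
    (hcardV : #V = 2 ^ 11)
    (hS : (univ.filter fun x : Fin (6 + 6) → Bool => Odd (u' x)) = V.image (bxor xP))
    (hS' : (univ.filter fun x : Fin (6 + 6) → Bool => ¬ Odd (u' x)) = V.image (bxor x')) (y : Fin (6 + 6) → Bool) :
    ∑ x ∈ ((univ.filter fun x : Fin (6 + 6) → Bool => ¬ Odd (u' x)).filter fun x => Odd ((u' x - 2 * sZ (f x)) / 2)), (((u' x - 2 * sZ (f x)) : ℤ) : ℝ) * twist x y = 0 ∨
    ∑ x ∈ ((univ.filter fun x : Fin (6 + 6) → Bool => ¬ Odd (u' x)).filter fun x => Odd ((u' x - 2 * sZ (f x)) / 2)), (((u' x - 2 * sZ (f x)) : ℤ) : ℝ) * twist x y = 512 ∨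
    ∑ x ∈ ((univ.filter fun x : Fin (6 + 6) → Bool => ¬ Odd (u' x)).filter fun x => Odd ((u' x - 2 * sZ (f x)) / 2)), (((u' x - 2 * sZ (f x)) : ℤ) : ℝ) * twist x y = -512 := by
  classical
  obtain ⟨hA256, hfour, -, -, -⟩ := l5t_layer2 f g hf hg u' hu' hodd hΦ h2
  obtain ⟨p, hp⟩ : ((univ.filter fun x : Fin (6 + 6) → Bool => ¬ Odd (u' x)).filter fun x => Odd ((u' x - 2 * sZ (f x)) / 2)).Nonempty := by
    rw [← card_pos, hA256]; norm_num
  obtain ⟨-, hUadd, hUcard, hcos⟩ := cc_flat f g hf hg u' hu' hodd hΦ h2 V xP x' h0 hadd hcardV hS hS'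
  have hA := hcos p hp
  set U := (V.filter fun a => ∀ x ∈ ((univ.filter fun x : Fin (6 + 6) → Bool => ¬ Odd (u' x)).filter fun x => Odd ((u' x - 2 * sZ (f x)) / 2)), bxor x a ∈ ((univ.filter fun x : Fin (6 + 6) → Bool => ¬ Odd (u' x)).filter fun x => Odd ((u' x - 2 * sZ (f x)) / 2))) with hU
  have hpm : ∀ x ∈ ((univ.filter fun x : Fin (6 + 6) → Bool => ¬ Odd (u' x)).filter fun x => Odd ((u' x - 2 * sZ (f x)) / 2)), (u' x - 2 * sZ (f x)) = 2 ∨ (u' x - 2 * sZ (f x)) = -2 := by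
    intro x hx
    have hx1 := mem_filter.1 hx
    have hsq : (u' x - 2 * sZ (f x)) ^ 2 = 4 := hfour x (mem_filter.1 hx1.1).2 hx1.2
    have h : ((u' x - 2 * sZ (f x)) - 2) * ((u' x - 2 * sZ (f x)) + 2) = 0 := by nlinarith
    rcases mul_eq_zero.1 h with h | h
    · left; linarith
    · right; linarith
  have hin : ∀ u ∈ U, bxor p u ∈ ((univ.filter fun x : Fin (6 + 6) → Bool => ¬ Odd (u' x)).filter fun x => Odd ((u' x - 2 * sZ (f x)) / 2)) := fun u hu => by
    rw [hA]; exact mem_image.2 ⟨u, hu, rfl⟩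
  have hp2 : (((u' p - 2 * sZ (f p)) : ℤ) : ℝ) ^ 2 = 4 := by
    rcases hpm p hp with h | h <;> rw [h] <;> norm_num
  -- the multiplicative sign function along `U`
  set η : (Fin (6 + 6) → Bool) → ℝ := fun u => (((u' p - 2 * sZ (f p)) : ℤ) : ℝ) * (((u' (bxor p u) - 2 * sZ (f (bxor p u))) : ℤ) : ℝ) / 4 * twist u y with hη
  have hη1 : ∀ u ∈ U, η u = 1 ∨ η u = -1 := by
    intro u hu
    simp only [η]
    rcases hpm p hp with h | h <;> rcases hpm _ (hin u hu) with h' | h' <;> rcases twist_eq_one_or u y with ht | ht <;>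
      rw [h, h', ht] <;> norm_num
  have hmul : ∀ u ∈ U, ∀ v ∈ U, η (bxor u v) = η u * η v := by
    intro u hu v hv
    have hs := cc_signs f g hf hg u' hu' hodd hΦ h2 V xP x' h0 hadd hcardV hS hS' p hp u v hu hv
    rw [iw_bxor_assoc] at hs
    have h4u : (u' (bxor p u) - 2 * sZ (f (bxor p u))) ^ 2 = 4 := by rcases hpm _ (hin u hu) with h | h <;> rw [h] <;> norm_num
    have h4v : (u' (bxor p v) - 2 * sZ (f (bxor p v))) ^ 2 = 4 := by rcases hpm _ (hin v hv) with h | h <;> rw [h] <;> norm_num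
    have h1 : ((u' (bxor p u) - 2 * sZ (f (bxor p u))) * (u' (bxor p v) - 2 * sZ (f (bxor p v)))) ^ 2 = 16 := by rw [mul_pow, h4u, h4v]; norm_num
    have h2' : (u' p - 2 * sZ (f p)) * (u' (bxor p (bxor u v)) - 2 * sZ (f (bxor p (bxor u v)))) * ((u' (bxor p u) - 2 * sZ (f (bxor p u))) * (u' (bxor p v) - 2 * sZ (f (bxor p v)))) ^ 2 =
        16 * ((u' (bxor p u) - 2 * sZ (f (bxor p u))) * (u' (bxor p v) - 2 * sZ (f (bxor p v)))) := by rw [← hs]; ring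
    rw [h1] at h2'
    have key : (u' p - 2 * sZ (f p)) * (u' (bxor p (bxor u v)) - 2 * sZ (f (bxor p (bxor u v)))) = (u' (bxor p u) - 2 * sZ (f (bxor p u))) * (u' (bxor p v) - 2 * sZ (f (bxor p v))) := by linarith
    have keyR : (((u' p - 2 * sZ (f p)) : ℤ) : ℝ) * (((u' (bxor p (bxor u v)) - 2 * sZ (f (bxor p (bxor u v)))) : ℤ) : ℝ) = (((u' (bxor p u) - 2 * sZ (f (bxor p u))) : ℤ) : ℝ) * (((u' (bxor p v) - 2 * sZ (f (bxor p v))) : ℤ) : ℝ) := by exact_mod_cast key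
    simp only [η]
    rw [twist_bxor_left u v y]
    linear_combination (twist u y * twist v y / 4) * keyR -
      (twist u y * twist v y * (((u' (bxor p u) - 2 * sZ (f (bxor p u))) : ℤ) : ℝ) * (((u' (bxor p v) - 2 * sZ (f (bxor p v))) : ℤ) : ℝ) / 16) * hp2
  have hsum := bd_hom_sum U hUadd η hη1 hmul
  -- `Ô(y) = e(p)(−1)^{p·y} · Σ_U η`
  have hinj : ∀ a ∈ U, ∀ b ∈ U, bxor p a = bxor p b → a = b := fun a _ b _ h => by
    have h' := congrArg (bxor p) h
    rwa [bxor_bxor_cancel_left, bxor_bxor_cancel_left] at h'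
  have hO : ∑ x ∈ ((univ.filter fun x : Fin (6 + 6) → Bool => ¬ Odd (u' x)).filter fun x => Odd ((u' x - 2 * sZ (f x)) / 2)), (((u' x - 2 * sZ (f x)) : ℤ) : ℝ) * twist x y = (((u' p - 2 * sZ (f p)) : ℤ) : ℝ) * twist p y * ∑ u ∈ U, η u := by
    rw [hA, sum_image hinj, mul_sum]
    refine sum_congr rfl fun u _ => ?_
    simp only [η]
    rw [twist_bxor_left p u y]
    linear_combination (-(twist p y * twist u y * (((u' (bxor p u) - 2 * sZ (f (bxor p u))) : ℤ) : ℝ) / 4)) * hp2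
  rw [hO]
  rcases hsum with h | h
  · left; rw [h, mul_zero]
  · rw [h, hUcard]
    right
    have hEp : (((u' p - 2 * sZ (f p)) : ℤ) : ℝ) = 2 ∨ (((u' p - 2 * sZ (f p)) : ℤ) : ℝ) = -2 := by
      rcases hpm p hp with h' | h'
      · left; exact_mod_cast h'
      · right; exact_mod_cast h'
    rcases hEp with h' | h' <;> rcases twist_eq_one_or p y with ht | ht <;> rw [h', ht] <;> norm_num

/-! ### 3. Parseval bookkeeping for `ê = ŝ + Ô` -/

/-- **Energies of the three transforms.**  In configuration (c): `e = e·1_P + e·1_A` pointwise, `Σ_y ê² = 4096·3072`, `Σ_y ŝ² = 4096·2048`,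
`Σ_y Ô² = 4096·1024` (Parseval, `sum_W_sq`), and `Ô` is the sum over `A`. [this work] -/
theorem bd_parseval (f g : (Fin (6 + 6) → Bool) → Bool) (hf : IsDegLeFun 3 f) (hg : IsDegLeFun 3 g)
    (u' : (Fin (6 + 6) → Bool) → ℤ) (hu' : ∀ x, W (fun y => signOf (g y)) x = (2 : ℝ) ^ 5 * (u' x : ℝ))
    (hodd : ∃ x, Odd (u' x)) (hΦ : (29 / 32 : ℝ) ≤ forrelation f g)
    (h2 : ∃ x, ¬ Odd (u' x) ∧ Odd ((u' x - 2 * sZ (f x)) / 2)) :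
    (∀ a, (((u' a - 2 * sZ (f a)) : ℤ) : ℝ) = (if Odd (u' a) then (((u' a - 2 * sZ (f a)) : ℤ) : ℝ) else 0) + (if a ∈ ((univ.filter fun x : Fin (6 + 6) → Bool => ¬ Odd (u' x)).filter fun x => Odd ((u' x - 2 * sZ (f x)) / 2)) then (((u' a - 2 * sZ (f a)) : ℤ) : ℝ) else 0)) ∧
    ∑ y, (∑ a, (((u' a - 2 * sZ (f a)) : ℤ) : ℝ) * twist a y) ^ 2 = 4096 * 3072 ∧
    ∑ y, (∑ a, (if Odd (u' a) then (((u' a - 2 * sZ (f a)) : ℤ) : ℝ) else 0) * twist a y) ^ 2 = 4096 * 2048 ∧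
    ∑ y, (∑ a, (if a ∈ ((univ.filter fun x : Fin (6 + 6) → Bool => ¬ Odd (u' x)).filter fun x => Odd ((u' x - 2 * sZ (f x)) / 2)) then (((u' a - 2 * sZ (f a)) : ℤ) : ℝ) else 0) * twist a y) ^ 2 = 4096 * 1024 ∧
    (∀ y, ∑ a, (if a ∈ ((univ.filter fun x : Fin (6 + 6) → Bool => ¬ Odd (u' x)).filter fun x => Odd ((u' x - 2 * sZ (f x)) / 2)) then (((u' a - 2 * sZ (f a)) : ℤ) : ℝ) else 0) * twist a y = ∑ x ∈ ((univ.filter fun x : Fin (6 + 6) → Bool => ¬ Odd (u' x)).filter fun x => Odd ((u' x - 2 * sZ (f x)) / 2)), (((u' x - 2 * sZ (f x)) : ℤ) : ℝ) * twist x y) ∧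
    (∀ y, ∑ a, (((u' a - 2 * sZ (f a)) : ℤ) : ℝ) * twist a y =
      ∑ a, (if Odd (u' a) then (((u' a - 2 * sZ (f a)) : ℤ) : ℝ) else 0) * twist a y + ∑ a, (if a ∈ ((univ.filter fun x : Fin (6 + 6) → Bool => ¬ Odd (u' x)).filter fun x => Odd ((u' x - 2 * sZ (f x)) / 2)) then (((u' a - 2 * sZ (f a)) : ℤ) : ℝ) else 0) * twist a y) := by
  classical
  obtain ⟨hA256, hfour, hzero, hone, -⟩ := l5t_layer2 f g hf hg u' hu' hodd hΦ h2
  have hPcard : #(univ.filter fun x : Fin (6 + 6) → Bool => Odd (u' x)) = 2048 := by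
    obtain ⟨V1, xP1, x1, -, -, -, -, -, hP, -⟩ := l5c_setup f g hg u' hu' hodd hΦ
    exact hP
  -- the three energies
  have hmemP : ∀ x, x ∈ (univ.filter fun x : Fin (6 + 6) → Bool => Odd (u' x)) ↔ Odd (u' x) := fun x => by simp
  have heP : ∑ x ∈ (univ.filter fun x : Fin (6 + 6) → Bool => Odd (u' x)), (((u' x - 2 * sZ (f x)) : ℤ) : ℝ) ^ 2 = 2048 := by
    have h1 : ∀ x ∈ (univ.filter fun x : Fin (6 + 6) → Bool => Odd (u' x)), (((u' x - 2 * sZ (f x)) : ℤ) : ℝ) ^ 2 = 1 := fun x hx => by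
      exact_mod_cast hone x ((hmemP x).1 hx)
    rw [sum_congr rfl h1, sum_const, hPcard]; norm_num
  have heA : ∑ x ∈ ((univ.filter fun x : Fin (6 + 6) → Bool => ¬ Odd (u' x)).filter fun x => Odd ((u' x - 2 * sZ (f x)) / 2)), (((u' x - 2 * sZ (f x)) : ℤ) : ℝ) ^ 2 = 1024 := by
    have h1 : ∀ x ∈ ((univ.filter fun x : Fin (6 + 6) → Bool => ¬ Odd (u' x)).filter fun x => Odd ((u' x - 2 * sZ (f x)) / 2)), (((u' x - 2 * sZ (f x)) : ℤ) : ℝ) ^ 2 = 4 := fun x hx => by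
      have hx1 := mem_filter.1 hx
      exact_mod_cast hfour x (mem_filter.1 hx1.1).2 hx1.2
    rw [sum_congr rfl h1, sum_const, hA256]; norm_num
  have heP' : ∑ x ∈ (univ.filter fun x : Fin (6 + 6) → Bool => ¬ Odd (u' x)), (((u' x - 2 * sZ (f x)) : ℤ) : ℝ) ^ 2 = 1024 := by
    rw [← sum_filter_add_sum_filter_not (univ.filter fun x : Fin (6 + 6) → Bool => ¬ Odd (u' x)) (fun x => Odd ((u' x - 2 * sZ (f x)) / 2)), heA]
    have hz : ∑ x ∈ (univ.filter fun x : Fin (6 + 6) → Bool => ¬ Odd (u' x)).filter (fun x => ¬ Odd ((u' x - 2 * sZ (f x)) / 2)), (((u' x - 2 * sZ (f x)) : ℤ) : ℝ) ^ 2 = 0 :=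
      sum_eq_zero fun x hx => by
        have hx1 := mem_filter.1 hx
        rw [hzero x (mem_filter.1 hx1.1).2 hx1.2]; simp
    rw [hz, add_zero]
  have hetot : ∑ x, (((u' x - 2 * sZ (f x)) : ℤ) : ℝ) ^ 2 = 3072 := by
    rw [← sum_filter_add_sum_filter_not univ (fun x : Fin (6 + 6) → Bool => Odd (u' x)), heP, heP']; norm_num
  -- the decomposition `e = e·1_P + e·1_A`
  have hdec : ∀ a, (((u' a - 2 * sZ (f a)) : ℤ) : ℝ) = (if Odd (u' a) then (((u' a - 2 * sZ (f a)) : ℤ) : ℝ) else 0) + (if a ∈ ((univ.filter fun x : Fin (6 + 6) → Bool => ¬ Odd (u' x)).filter fun x => Odd ((u' x - 2 * sZ (f x)) / 2)) then (((u' a - 2 * sZ (f a)) : ℤ) : ℝ) else 0) := by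
    intro a
    by_cases ho : Odd (u' a)
    · have hna : a ∉ ((univ.filter fun x : Fin (6 + 6) → Bool => ¬ Odd (u' x)).filter fun x => Odd ((u' x - 2 * sZ (f x)) / 2)) := fun h => (mem_filter.1 (mem_filter.1 h).1).2 ho
      rw [if_pos ho, if_neg hna, add_zero]
    · rw [if_neg ho, zero_add]
      by_cases ha : a ∈ ((univ.filter fun x : Fin (6 + 6) → Bool => ¬ Odd (u' x)).filter fun x => Odd ((u' x - 2 * sZ (f x)) / 2))
      · rw [if_pos ha]
      · rw [if_neg ha]
        have ho2 : ¬ Odd ((u' a - 2 * sZ (f a)) / 2) := fun h => ha (mem_filter.2 ⟨mem_filter.2 ⟨mem_univ _, ho⟩, h⟩)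
        rw [hzero a ho ho2]; simp
  -- Parseval for `ê`, `ŝ`, `Ô`
  have hPe : ∑ y, (∑ a, (((u' a - 2 * sZ (f a)) : ℤ) : ℝ) * twist a y) ^ 2 = 4096 * 3072 := by
    have h := sum_W_sq (fun a => (((u' a - 2 * sZ (f a)) : ℤ) : ℝ))
    unfold W at h
    rw [h, hetot]; norm_num
  have hPs : ∑ y, (∑ a, (if Odd (u' a) then (((u' a - 2 * sZ (f a)) : ℤ) : ℝ) else 0) * twist a y) ^ 2 = 4096 * 2048 := by
    have h := sum_W_sq (fun a => if Odd (u' a) then (((u' a - 2 * sZ (f a)) : ℤ) : ℝ) else 0)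
    unfold W at h
    rw [h]
    have h1 : ∑ a, (if Odd (u' a) then (((u' a - 2 * sZ (f a)) : ℤ) : ℝ) else 0) ^ 2 = ∑ x ∈ (univ.filter fun x : Fin (6 + 6) → Bool => Odd (u' x)), (((u' x - 2 * sZ (f x)) : ℤ) : ℝ) ^ 2 := by
      rw [sum_filter]; exact sum_congr rfl fun a _ => by split_ifs <;> simp
    rw [h1, heP]; norm_num
  have hPO : ∑ y, (∑ a, (if a ∈ ((univ.filter fun x : Fin (6 + 6) → Bool => ¬ Odd (u' x)).filter fun x => Odd ((u' x - 2 * sZ (f x)) / 2)) then (((u' a - 2 * sZ (f a)) : ℤ) : ℝ) else 0) * twist a y) ^ 2 = 4096 * 1024 := by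
    have h := sum_W_sq (fun a => if a ∈ ((univ.filter fun x : Fin (6 + 6) → Bool => ¬ Odd (u' x)).filter fun x => Odd ((u' x - 2 * sZ (f x)) / 2)) then (((u' a - 2 * sZ (f a)) : ℤ) : ℝ) else 0)
    unfold W at h
    rw [h]
    have h1 : ∑ a, (if a ∈ ((univ.filter fun x : Fin (6 + 6) → Bool => ¬ Odd (u' x)).filter fun x => Odd ((u' x - 2 * sZ (f x)) / 2)) then (((u' a - 2 * sZ (f a)) : ℤ) : ℝ) else 0) ^ 2 = ∑ x ∈ ((univ.filter fun x : Fin (6 + 6) → Bool => ¬ Odd (u' x)).filter fun x => Odd ((u' x - 2 * sZ (f x)) / 2)), (((u' x - 2 * sZ (f x)) : ℤ) : ℝ) ^ 2 := by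
      have e1 : univ.filter (fun a => a ∈ ((univ.filter fun x : Fin (6 + 6) → Bool => ¬ Odd (u' x)).filter fun x => Odd ((u' x - 2 * sZ (f x)) / 2))) = ((univ.filter fun x : Fin (6 + 6) → Bool => ¬ Odd (u' x)).filter fun x => Odd ((u' x - 2 * sZ (f x)) / 2)) := by ext a; simp
      calc ∑ a, (if a ∈ ((univ.filter fun x : Fin (6 + 6) → Bool => ¬ Odd (u' x)).filter fun x => Odd ((u' x - 2 * sZ (f x)) / 2)) then (((u' a - 2 * sZ (f a)) : ℤ) : ℝ) else 0) ^ 2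
          = ∑ a, (if a ∈ ((univ.filter fun x : Fin (6 + 6) → Bool => ¬ Odd (u' x)).filter fun x => Odd ((u' x - 2 * sZ (f x)) / 2)) then (((u' a - 2 * sZ (f a)) : ℤ) : ℝ) ^ 2 else 0) := sum_congr rfl fun a _ => by split_ifs <;> simp
        _ = ∑ x ∈ univ.filter (fun a => a ∈ ((univ.filter fun x : Fin (6 + 6) → Bool => ¬ Odd (u' x)).filter fun x => Odd ((u' x - 2 * sZ (f x)) / 2))), (((u' x - 2 * sZ (f x)) : ℤ) : ℝ) ^ 2 := (sum_filter _ _).symm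
        _ = ∑ x ∈ ((univ.filter fun x : Fin (6 + 6) → Bool => ¬ Odd (u' x)).filter fun x => Odd ((u' x - 2 * sZ (f x)) / 2)), (((u' x - 2 * sZ (f x)) : ℤ) : ℝ) ^ 2 := by rw [e1]
    rw [h1, heA]; norm_num
  -- `Ô` as a sum over `A`, and `ê = ŝ + Ô`
  have hOsum : ∀ y, ∑ a, (if a ∈ ((univ.filter fun x : Fin (6 + 6) → Bool => ¬ Odd (u' x)).filter fun x => Odd ((u' x - 2 * sZ (f x)) / 2)) then (((u' a - 2 * sZ (f a)) : ℤ) : ℝ) else 0) * twist a y = ∑ x ∈ ((univ.filter fun x : Fin (6 + 6) → Bool => ¬ Odd (u' x)).filter fun x => Odd ((u' x - 2 * sZ (f x)) / 2)), (((u' x - 2 * sZ (f x)) : ℤ) : ℝ) * twist x y := by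
    intro y
    have e1 : univ.filter (fun a => a ∈ ((univ.filter fun x : Fin (6 + 6) → Bool => ¬ Odd (u' x)).filter fun x => Odd ((u' x - 2 * sZ (f x)) / 2))) = ((univ.filter fun x : Fin (6 + 6) → Bool => ¬ Odd (u' x)).filter fun x => Odd ((u' x - 2 * sZ (f x)) / 2)) := by ext a; simp
    have h1 : ∀ a, (if a ∈ ((univ.filter fun x : Fin (6 + 6) → Bool => ¬ Odd (u' x)).filter fun x => Odd ((u' x - 2 * sZ (f x)) / 2)) then (((u' a - 2 * sZ (f a)) : ℤ) : ℝ) else 0) * twist a y =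
        if a ∈ ((univ.filter fun x : Fin (6 + 6) → Bool => ¬ Odd (u' x)).filter fun x => Odd ((u' x - 2 * sZ (f x)) / 2)) then (((u' a - 2 * sZ (f a)) : ℤ) : ℝ) * twist a y else 0 := fun a => by split_ifs <;> simp
    rw [sum_congr rfl (fun a _ => h1 a), ← sum_filter, e1]
  have hsplit : ∀ y, ∑ a, (((u' a - 2 * sZ (f a)) : ℤ) : ℝ) * twist a y =
      ∑ a, (if Odd (u' a) then (((u' a - 2 * sZ (f a)) : ℤ) : ℝ) else 0) * twist a y + ∑ a, (if a ∈ ((univ.filter fun x : Fin (6 + 6) → Bool => ¬ Odd (u' x)).filter fun x => Odd ((u' x - 2 * sZ (f x)) / 2)) then (((u' a - 2 * sZ (f a)) : ℤ) : ℝ) else 0) * twist a y := by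
    intro y
    rw [← sum_add_distrib]
    exact sum_congr rfl fun a _ => by rw [← add_mul, ← hdec a]
  exact ⟨hdec, hPe, hPs, hPO, hOsum, hsplit⟩

/-! ### 4. Two level-5 sides cannot face each other -/

/-- **No cubic pair on 12 bits with both sides at level 5 and `Φ ≥ 29/32`**: `W_g = 32u'` with some `u'(x)` odd and `W_f = 32u_f` with some
`u_f(y)` odd are incompatible with `Φ(f,g) ≥ 29/32`.  Hence the partner of a level-5 (configuration (c)) side has `W ∈ 64ℤ`.  NOT summit
progress. [this work] -/
theorem tw23_levelFive_both_false (f g : (Fin (6 + 6) → Bool) → Bool) (hf : IsDegLeFun 3 f) (hg : IsDegLeFun 3 g)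
    (u' : (Fin (6 + 6) → Bool) → ℤ) (hu' : ∀ x, W (fun y => signOf (g y)) x = (2 : ℝ) ^ 5 * (u' x : ℝ))
    (hodd : ∃ x, Odd (u' x))
    (uf : (Fin (6 + 6) → Bool) → ℤ) (huf : ∀ y, W (fun x => signOf (f x)) y = (2 : ℝ) ^ 5 * (uf y : ℝ))
    (hoddf : ∃ y, Odd (uf y)) (hΦ : (29 / 32 : ℝ) ≤ forrelation f g) : False := by
  classical
  -- both sides are in configuration (c)
  have h2 := tw23_levelFive_ge2932_shape f g hf hg u' hu' hodd hΦ
  obtain ⟨V, xP, x', h0, hadd, hcardV, hS, hS', hPcard, -, -, -, -, -⟩ := l5c_setup f g hg u' hu' hodd hΦ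
  obtain ⟨hA256, hfour, hzero, hone, -⟩ := l5t_layer2 f g hf hg u' hu' hodd hΦ h2
  have hΦ' : (29 / 32 : ℝ) ≤ forrelation g f := by
    rw [Summit.QuantumAdvantage.QuantumAdvantage.Theorems.SignedCubicForrelationNotPrBPP.Negative.HalfQuad.forrelation_comm]; exact hΦ
  have h2f := tw23_levelFive_ge2932_shape g f hg hf uf huf hoddf hΦ'
  obtain ⟨-, hfour_f, hzero_f, hone_f, -⟩ := l5t_layer2 g f hg hf uf huf hoddf hΦ' h2f
  -- `|e_f| ≤ 2`, hence `|ê| ≤ 128`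
  have hef : ∀ y, (uf y - 2 * sZ (g y)) ^ 2 ≤ 4 := by
    intro y
    by_cases ho : Odd (uf y)
    · rw [hone_f y ho]; norm_num
    · by_cases ho2 : Odd ((uf y - 2 * sZ (g y)) / 2)
      · rw [hfour_f y ho ho2]
      · rw [hzero_f y ho ho2]; norm_num
  have hE : ∀ y, |∑ a, (((u' a - 2 * sZ (f a)) : ℤ) : ℝ) * twist a y| ≤ 128 := by
    intro y
    rw [l5k_duality f g u' hu' uf huf y, abs_mul]
    have h := hef y
    have hb : |(((uf y - 2 * sZ (g y) : ℤ)) : ℝ)| ≤ 2 := by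
      rw [abs_le]
      have h1 : -2 ≤ uf y - 2 * sZ (g y) ∧ uf y - 2 * sZ (g y) ≤ 2 := by constructor <;> nlinarith
      exact ⟨by exact_mod_cast h1.1, by exact_mod_cast h1.2⟩
    have : |(-64 : ℝ)| = 64 := by norm_num
    rw [this]
    linarith
  obtain ⟨hdec, hPe, hPs, hPO, hOsum, hsplit⟩ := bd_parseval f g hf hg u' hu' hodd hΦ h2
  -- the cross term `Σ ê·Ô = 2²²`
  have hcross : ∑ y, (∑ a, (((u' a - 2 * sZ (f a)) : ℤ) : ℝ) * twist a y) * (∑ a, (if a ∈ ((univ.filter fun x : Fin (6 + 6) → Bool => ¬ Odd (u' x)).filter fun x => Odd ((u' x - 2 * sZ (f x)) / 2)) then (((u' a - 2 * sZ (f a)) : ℤ) : ℝ) else 0) * twist a y) = 4194304 := by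
    have hx : ∑ y, ((∑ a, (((u' a - 2 * sZ (f a)) : ℤ) : ℝ) * twist a y) - ∑ a, (if a ∈ ((univ.filter fun x : Fin (6 + 6) → Bool => ¬ Odd (u' x)).filter fun x => Odd ((u' x - 2 * sZ (f x)) / 2)) then (((u' a - 2 * sZ (f a)) : ℤ) : ℝ) else 0) * twist a y) ^ 2 = 4096 * 2048 := by
      rw [← hPs]
      exact sum_congr rfl fun y _ => by rw [hsplit y]; ring
    have hexp : ∀ y, ((∑ a, (((u' a - 2 * sZ (f a)) : ℤ) : ℝ) * twist a y) - ∑ a, (if a ∈ ((univ.filter fun x : Fin (6 + 6) → Bool => ¬ Odd (u' x)).filter fun x => Odd ((u' x - 2 * sZ (f x)) / 2)) then (((u' a - 2 * sZ (f a)) : ℤ) : ℝ) else 0) * twist a y) ^ 2 =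
        (∑ a, (((u' a - 2 * sZ (f a)) : ℤ) : ℝ) * twist a y) ^ 2 + (∑ a, (if a ∈ ((univ.filter fun x : Fin (6 + 6) → Bool => ¬ Odd (u' x)).filter fun x => Odd ((u' x - 2 * sZ (f x)) / 2)) then (((u' a - 2 * sZ (f a)) : ℤ) : ℝ) else 0) * twist a y) ^ 2 -
          2 * ((∑ a, (((u' a - 2 * sZ (f a)) : ℤ) : ℝ) * twist a y) * (∑ a, (if a ∈ ((univ.filter fun x : Fin (6 + 6) → Bool => ¬ Odd (u' x)).filter fun x => Odd ((u' x - 2 * sZ (f x)) / 2)) then (((u' a - 2 * sZ (f a)) : ℤ) : ℝ) else 0) * twist a y)) := fun y => by ring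
    rw [sum_congr rfl (fun y _ => hexp y), sum_sub_distrib, sum_add_distrib, ← mul_sum, hPe, hPO] at hx
    linarith
  -- but `Σ ê·Ô ≤ 128·Σ|Ô| = 128·8192`
  have hOabs : ∀ y, |∑ a, (if a ∈ ((univ.filter fun x : Fin (6 + 6) → Bool => ¬ Odd (u' x)).filter fun x => Odd ((u' x - 2 * sZ (f x)) / 2)) then (((u' a - 2 * sZ (f a)) : ℤ) : ℝ) else 0) * twist a y| =
      (∑ a, (if a ∈ ((univ.filter fun x : Fin (6 + 6) → Bool => ¬ Odd (u' x)).filter fun x => Odd ((u' x - 2 * sZ (f x)) / 2)) then (((u' a - 2 * sZ (f a)) : ℤ) : ℝ) else 0) * twist a y) ^ 2 / 512 := by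
    intro y
    rw [hOsum y]
    rcases bd_Ohat f g hf hg u' hu' hodd hΦ h2 V xP x' h0 hadd hcardV hS hS' y with h | h | h <;> rw [h] <;> norm_num
  have habs : ∑ y, |∑ a, (if a ∈ ((univ.filter fun x : Fin (6 + 6) → Bool => ¬ Odd (u' x)).filter fun x => Odd ((u' x - 2 * sZ (f x)) / 2)) then (((u' a - 2 * sZ (f a)) : ℤ) : ℝ) else 0) * twist a y| = 8192 := by
    rw [sum_congr rfl (fun y _ => hOabs y), ← sum_div, hPO]; norm_num
  have hbound : ∑ y, (∑ a, (((u' a - 2 * sZ (f a)) : ℤ) : ℝ) * twist a y) * (∑ a, (if a ∈ ((univ.filter fun x : Fin (6 + 6) → Bool => ¬ Odd (u' x)).filter fun x => Odd ((u' x - 2 * sZ (f x)) / 2)) then (((u' a - 2 * sZ (f a)) : ℤ) : ℝ) else 0) * twist a y) ≤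
      ∑ y, 128 * |∑ a, (if a ∈ ((univ.filter fun x : Fin (6 + 6) → Bool => ¬ Odd (u' x)).filter fun x => Odd ((u' x - 2 * sZ (f x)) / 2)) then (((u' a - 2 * sZ (f a)) : ℤ) : ℝ) else 0) * twist a y| := by
    refine sum_le_sum fun y _ => ?_
    calc (∑ a, (((u' a - 2 * sZ (f a)) : ℤ) : ℝ) * twist a y) * (∑ a, (if a ∈ ((univ.filter fun x : Fin (6 + 6) → Bool => ¬ Odd (u' x)).filter fun x => Odd ((u' x - 2 * sZ (f x)) / 2)) then (((u' a - 2 * sZ (f a)) : ℤ) : ℝ) else 0) * twist a y)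
        ≤ |(∑ a, (((u' a - 2 * sZ (f a)) : ℤ) : ℝ) * twist a y) * (∑ a, (if a ∈ ((univ.filter fun x : Fin (6 + 6) → Bool => ¬ Odd (u' x)).filter fun x => Odd ((u' x - 2 * sZ (f x)) / 2)) then (((u' a - 2 * sZ (f a)) : ℤ) : ℝ) else 0) * twist a y)| := le_abs_self _
      _ = |∑ a, (((u' a - 2 * sZ (f a)) : ℤ) : ℝ) * twist a y| * |∑ a, (if a ∈ ((univ.filter fun x : Fin (6 + 6) → Bool => ¬ Odd (u' x)).filter fun x => Odd ((u' x - 2 * sZ (f x)) / 2)) then (((u' a - 2 * sZ (f a)) : ℤ) : ℝ) else 0) * twist a y| := abs_mul _ _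
      _ ≤ 128 * |∑ a, (if a ∈ ((univ.filter fun x : Fin (6 + 6) → Bool => ¬ Odd (u' x)).filter fun x => Odd ((u' x - 2 * sZ (f x)) / 2)) then (((u' a - 2 * sZ (f a)) : ℤ) : ℝ) else 0) * twist a y| :=
          mul_le_mul_of_nonneg_right (hE y) (abs_nonneg _)
  rw [← mul_sum, habs] at hbound
  linarith

/-- **Packaged**: at `Φ ≥ 29/32` a level-5 side forces its partner to Ax level `≥ 6` (`W_f ∈ 64ℤ`). [this work] -/
theorem tw23_levelFive_partner_levelSix (f g : (Fin (6 + 6) → Bool) → Bool) (hf : IsDegLeFun 3 f) (hg : IsDegLeFun 3 g)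
    (u' : (Fin (6 + 6) → Bool) → ℤ) (hu' : ∀ x, W (fun y => signOf (g y)) x = (2 : ℝ) ^ 5 * (u' x : ℝ))
    (hodd : ∃ x, Odd (u' x)) (hΦ : (29 / 32 : ℝ) ≤ forrelation f g) :
    ∃ u'' : (Fin (6 + 6) → Bool) → ℤ, ∀ y, W (fun x => signOf (f x)) y = (2 : ℝ) ^ 6 * (u'' y : ℝ) := by
  obtain ⟨-, ⟨uf, huf⟩⟩ := tw23_ge2932_levelFive f g hf hg hΦ
  have hO : ∀ y, ¬ Odd (uf y) := fun y hy => tw23_levelFive_both_false f g hf hg u' hu' hodd uf huf ⟨y, hy⟩ hΦ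
  exact ⟨fun y => uf y / 2, tw_level_up (j := 5) f uf huf hO⟩

end Summit.QuantumAdvantage.QuantumAdvantage.Theorems.CubicForrelation.NearExactIsExact

end
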